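import Mathlib
import Literature.MathematicalPhysics.QuantumFieldTheory.Dimock2011to13.MinimizerSupNormBound

/-!
# Dimock, *The renormalization group according to Balaban* II, §2.5, proof of LEMMA 2.6 (`\label{bonfire}`): «Here all the
# pieces have pointwise bounds of the form we want and this yields the result» — the COMPOSITION OF BLOCK-DECAYING KERNELS
# (`G_j(□̃)Q_jᵀC_j(□̃ ∩ δΩ_{j+1})Q_jG_j(□̃)` from the bounds on its factors), PROVED: products of operators with block-kernel
# decay have block-kernel decay (one-link sum; half the rate for exponential profiles; no loss for block-local factors),
# and the remark (another) ⟸ (lefty) for `|j − j′| ≤ 1`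

**Citation header (reproduction of PUBLISHED work; template of the Bałaban lattice Yang–Mills cell).**
J. Dimock, *The renormalization group according to Balaban II. Large fields*, J. Math. Phys. **54** (2013) 092301
(= arXiv:1212.5562v2) [Dimock2013BalabanII], §2.5: LEMMA 2.6 `\label{bonfire}` (lefty) L1185–1199, Remark 2 (another)
L1207–1218, proof L1224–1308 — the two-level case L1252–1287 with *"([Bal84b], p. 230)"* L1268–1271 and *"Here all the
pieces have pointwise bounds of the form we want and this yields the the result"* L1272–1273, the piece L1274–1283;
THEOREM 2.2 `\label{th}` proof, chain estimate L1440–1456; (funnysum) L1152–1156.  TeX line numbers refer to the arXiv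
source held by the cell on this hub at `run/shared/lean/archive/nearmiss/qft-balaban/dimock/src/1212.5562/1212.5562.tex`
(7217 lines, sha256[:16] 75c5792fc48eacbc).  Dimock's papers are published and refereed and are the cell's TEMPLATE, not
manuscripts under audit; no quantity of the Bałaban series is touched.

**What the paper prints (verbatim).**  L1268–1283: *"In this case we use the identity ([Bal84b], p. 230) G′_j(□̃) = G_j(□̃) +
a_j²G_j(□̃)Q_jᵀC_j(□̃ ∩ δΩ_{j+1})Q_jG_j(□̃)  Here all the pieces have pointwise bounds of the form we want and this yields the
the result. For G_j(□̃) use (gong1) and for C_j(□̃ ∩ δΩ_j) see [Bal83b] or Appendix D in part I. Also note the following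
piece of the estimate. If the L-cube Δ_{y′} is written as a union of unit cubes Δ_{y″} then for x ∈ Δ_y, supp f ⊂ Δ_{y′}
|(G_j(□̃)f)(x)| ≤ Σ_{y″}|(G_j(□̃)1_{Δ_{y″}}f)(x)| ≤ CΣ_{y″}e^{−γ₀d(y,y″)}‖f‖_∞ ≤ Ce^{−½γ₀d(y,y′)}‖f‖_∞  Here we used d(y,y″) ≥
d(y,y′) − L"*.  (another) L1205–1218: *"There is another way to state this bound which will be useful. It is
|1_{Δ_y}G_{k,Ω}(□̃)1_{Δ_{y′}}f|, L^{−(k−j)}|1_{Δ_y}∂G_{k,Ω}(□̃)1_{Δ_{y′}}f|, L^{−(1+α)(k−j)}|1_{Δ_y}δ_α∂G_{k,Ω}(□̃)1_{Δ_{y′}}f| ≤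
CL^{−2(k−j′)}e^{−½γ₀d_Ω(y,y′)}‖f‖_∞  Since |j − j′| ≤ 1 this follows from (lefty)."*  THEOREM 2.2's proof L1451–1456: *"In the
last step we use Σ_{j=0}^n d_Ω(y_j,y_{j+1}) ≥ d_Ω(y,y′) to extract a factor e^{−¼γ₀d_Ω(y,y′)}, and then use (funnysum) with δ
= ½γ₀ repeatedly."*

**Why this module.**  The siblings make kernel (i) the IDENTITY of L1268–1271 (`NextScalePropagatorIdentity.GkO_next_eq`,
v8.92) and (ii) the sup-norm ASSEMBLY from block-kernel decay (`MinimizerSupNormBound`, v8.91).  What turns (i) into the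
bound (gong1) for `G′_j(□̃)` is the sentence L1272 — *"all the pieces have pointwise bounds of the form we want and this
yields the result"* — i.e. the fact that a PRODUCT of operators each of which has block-kernel decay again has
block-kernel decay, the price being a one-link sum of the kind THEOREM 2.2's proof extracts (half the rate pays for the
sum, half survives; block-local factors `Q_j`, `Q_jᵀ` cost nothing).  This is the composition rule every random-walk
argument of the series uses tacitly; this module proves it in the block formalism of `MinimizerSupNormBound`, so that it
chains (the conclusion has the shape of the hypothesis), together with the arithmetic of Remark 2 ((another) ⟸ (lefty)).

**What is reproduced here (kernel-checked, zero `sorry`; Mathlib + `MinimizerSupNormBound`).**  Site types `X₁ →(T₁) X₂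
→(T₂) X₃` with cube maps `c_i : X_i → Y` into one set of cubes, linear `T₁`, `T₂`, decay hypotheses in the block form
`|(T_ig)(x)| ≤ C_i·E_i(c x, y′)·‖g‖_∞` for `g` supported in `Δ_{y′}`.
* §1 `norm_blk_le_of_bound` (a uniform bound on a cube bounds the block's sup norm).
* §2 **`norm_blk_apply_le`** (the block of `T₁g` at `Δ_{y″}` is `≤ C₁E₁(y″,y′)‖g‖_∞`); **`comp_decay`**: `|(T₂T₁g)(x)| ≤
  C₁C₂(Σ_{y″}E₂(c₃x,y″)E₁(y″,y′))‖g‖_∞` — insert `Σ_{y″}1_{Δ_{y″}}` between the factors (`MinimizerSupNormBound.abs_apply_le_of_decay`);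
  **`comp_decay_of_chain`**: with `Σ_{y″}E₂(y,y″)E₁(y″,y′) ≤ K·E(y,y′)` the composite `T₂ ∘ₗ T₁` has block decay `C₁C₂K·E` (same
  hypothesis shape ⟹ iterable: `G_jQ_jᵀC_jQ_jG_j`); **`comp_decay_of_local_left`** ∕ **`comp_decay_of_local_right`** (a
  block-local factor — multiplication operators, `1_{Δ_y}`, the averaging maps — costs no decay).
* §3 **`sum_exp_mul_exp_le`** (`Σ_{y″}e^{−γd(y,y″)}e^{−γd(y″,y′)} ≤ K·e^{−½γd(y,y′)}` from the triangle inequality and the one-link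
  sum at rate `½γ` — the `n = 1` chain estimate); **`comp_exp_decay`** (two factors `C_ie^{−γd}` compose to `C₁C₂K·e^{−½γd}`).
* §4 **`weight_target_le_source`** (`L^{−2(k−j)} ≤ L²L^{−2(k−j′)}` for `j ≤ j′ + 1`, `L ≥ 1`), **`another_of_lefty`** ((another)
  from (lefty) with constant `CL²`).
* §5 a non-vacuity `example` (two cubes, identity factors, profile `[y = y′]`, the bound of `comp_decay_of_chain` attained).

**Readings / located items (declared).**  (i) "Bounds of the form we want" is read as block-kernel decay in the shape
of (lefty)∕(gong1)∕(lefty2) with an abstract profile `E`; the RATE LOSS per composition is made explicit (exponential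
profiles: `γ ↦ ½γ` with the constant `K` of the one-link sum), where the print absorbs such changes into `C`, `γ₀ =
𝒪(L^{−2})` (Lemma 2.6 states (lefty) with `½γ₀` against (gong1)'s `γ₀`).  (ii) The piece L1274–1283 (an `L`-cube source
decomposed into unit cubes, `d(y,y″) ≥ d(y,y′) − L`) is the sibling's `abs_apply_le_of_decay` followed by a one-link sum; it
is not separately instantiated.  (iii) (another): the print's `|j − j′| ≤ 1` is used only as `j ≤ j′ + 1` (the direction
that matters for `L^{−2(k−j)} ≤ L²L^{−2(k−j′)}`); ℕ-truncated exponents as in the siblings.  (iv) L1273 *"the the result"*,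
L1272 *"C_j(□̃ ∩ δΩ_j)"* for `δΩ_{j+1}` — located typos (recorded in v8.92 already).

**What is NOT claimed.**  (gong1) for `G_j(□̃)` and the bounds on `C_j(□̃ ∩ δΩ_{j+1})` (*"see [Bal83b] or Appendix D in part
I"*), hence (lefty) itself; THEOREM 2.2; the derivative∕Hölder lines; the `L²`-to-pointwise step L1290–1306; anything of
[Bal84b]∕B6; anything of B1–B16 (row «D2 §2.5» B-side loci untouched, grade T unchanged).  NOT summit progress; NOT a
statement about any Bałaban paper; NOT continuum; NOT Clay.  NEW leaf; imports Mathlib + `MinimizerSupNormBound`; no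
Summits import; modifies nothing.  Unit `b2b-balaban-template` gen 36 (journal CLAIM D2-KERNEL-COMPOSITION).

**Version.**  v1 (gen 36, literature-prover-b2b-balaban-template-g36-0, 2026-08-20).
-/

noncomputable section

open Finset

namespace Literature.MathematicalPhysics.QuantumFieldTheory.Dimock2011to13.DecayingKernelComposition

open Literature.MathematicalPhysics.QuantumFieldTheory.Dimock2011to13.MinimizerSupNormBound

/-! ## §1 Blocks of an image: the decay hypothesis bounds the blocks of `T₁g` -/

section Blocks

variable {X Y : Type*} [Fintype X] [DecidableEq Y]

/-- a uniform bound on a cube bounds the sup norm of the block. [cite: Dimock2013BalabanII, §2.5 Theorem th (lefty2)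
L1334–1346 (arXiv:1212.5562v2 TeX)] -/
theorem norm_blk_le_of_bound (c : X → Y) (y : Y) (h : X → ℝ) {B : ℝ} (hB0 : 0 ≤ B)
    (hB : ∀ x, c x = y → |h x| ≤ B) : ‖blk c y h‖ ≤ B := by
  refine (pi_norm_le_iff_of_nonneg hB0).2 fun x => ?_
  rw [Real.norm_eq_abs, blk_apply]
  by_cases hx : c x = y
  · rw [if_pos hx]; exact hB x hx
  · rw [if_neg hx, abs_zero]; exact hB0

end Blocks

/-! ## §2 Composition: block-kernel decay of `T₂ ∘ T₁` from that of `T₁`, `T₂` -/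

section Composition

variable {X₁ X₂ X₃ Y : Type*} [Fintype X₁] [Fintype X₂] [Fintype Y] [DecidableEq Y]
variable {c₁ : X₁ → Y} {c₂ : X₂ → Y} {c₃ : X₃ → Y}
variable {T₁ : (X₁ → ℝ) →ₗ[ℝ] (X₂ → ℝ)} {T₂ : (X₂ → ℝ) →ₗ[ℝ] (X₃ → ℝ)}

omit [Fintype Y] in
/-- the block of `T₁g` at the cube `Δ_{y″}`, for `g` supported in `Δ_{y′}`, has sup norm `≤ C₁E₁(y″,y′)‖g‖_∞` — the decay
hypothesis read blockwise. [cite: Dimock2013BalabanII, §2.5 Lemma bonfire (lefty) L1185–1199 and (gong1) L1238–1245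
(arXiv:1212.5562v2 TeX)] -/
theorem norm_blk_apply_le {C₁ : ℝ} {E₁ : Y → Y → ℝ} (hC₁ : 0 ≤ C₁) (hE₁ : ∀ y y', 0 ≤ E₁ y y')
    (hker₁ : ∀ (y' : Y) (g : X₁ → ℝ), (∀ x, c₁ x ≠ y' → g x = 0) →
      ∀ x : X₂, |T₁ g x| ≤ C₁ * E₁ (c₂ x) y' * ‖g‖)
    {y' : Y} {g : X₁ → ℝ} (hg : ∀ x, c₁ x ≠ y' → g x = 0) (y'' : Y) :
    ‖blk c₂ y'' (T₁ g)‖ ≤ C₁ * E₁ y'' y' * ‖g‖ :=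
  norm_blk_le_of_bound c₂ y'' (T₁ g) (mul_nonneg (mul_nonneg hC₁ (hE₁ _ _)) (norm_nonneg _)) fun x hx => by
    rw [← hx]; exact hker₁ y' g hg x

/-- **COMPOSITION OF BLOCK-DECAYING KERNELS** (the mechanism behind *"all the pieces have pointwise bounds of the form we
want and this yields the result"*): if `|(T₁1_{Δ_{y′}}g)(x₂)| ≤ C₁E₁(y″,y′)‖g‖_∞` on `Δ_{y″}` and `|(T₂1_{Δ_{y″}}h)(x₃)| ≤
C₂E₂(y,y″)‖h‖_∞` on `Δ_y`, then `|(T₂T₁1_{Δ_{y′}}g)(x₃)| ≤ C₁C₂(Σ_{y″}E₂(y,y″)E₁(y″,y′))‖g‖_∞` on `Δ_y` — insert the partition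
`Σ_{y″}1_{Δ_{y″}}` between the factors. [cite: Dimock2013BalabanII, §2.5 Lemma bonfire proof L1268–1283 (arXiv:1212.5562v2 TeX)] -/
theorem comp_decay {C₁ C₂ : ℝ} {E₁ E₂ : Y → Y → ℝ} (hC₁ : 0 ≤ C₁) (hC₂ : 0 ≤ C₂) (hE₁ : ∀ y y', 0 ≤ E₁ y y')
    (hE₂ : ∀ y y', 0 ≤ E₂ y y')
    (hker₁ : ∀ (y' : Y) (g : X₁ → ℝ), (∀ x, c₁ x ≠ y' → g x = 0) →
      ∀ x : X₂, |T₁ g x| ≤ C₁ * E₁ (c₂ x) y' * ‖g‖)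
    (hker₂ : ∀ (y'' : Y) (h : X₂ → ℝ), (∀ x, c₂ x ≠ y'' → h x = 0) →
      ∀ x : X₃, |T₂ h x| ≤ C₂ * E₂ (c₃ x) y'' * ‖h‖)
    (y' : Y) (g : X₁ → ℝ) (hg : ∀ x, c₁ x ≠ y' → g x = 0) (x : X₃) :
    |T₂ (T₁ g) x| ≤ C₁ * C₂ * (∑ y'', E₂ (c₃ x) y'' * E₁ y'' y') * ‖g‖ := by
  have hker₂' : ∀ (y'' : Y) (h : X₂ → ℝ), (∀ x, c₂ x ≠ y'' → h x = 0) →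
      ∀ x : X₃, |T₂ h x| ≤ C₂ * (fun _ : Y => (1 : ℝ)) y'' * E₂ (c₃ x) y'' * ‖h‖ := fun y'' h hh x => by
    simpa using hker₂ y'' h hh x
  calc |T₂ (T₁ g) x| ≤ ∑ y'', C₂ * (fun _ : Y => (1 : ℝ)) y'' * E₂ (c₃ x) y'' * ‖blk c₂ y'' (T₁ g)‖ :=
        abs_apply_le_of_decay hker₂' (T₁ g) x
    _ ≤ ∑ y'', C₂ * E₂ (c₃ x) y'' * (C₁ * E₁ y'' y' * ‖g‖) := Finset.sum_le_sum fun y'' _ => by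
        rw [show C₂ * (fun _ : Y => (1 : ℝ)) y'' = C₂ from mul_one C₂]
        exact mul_le_mul_of_nonneg_left (norm_blk_apply_le hC₁ hE₁ hker₁ hg y'') (mul_nonneg hC₂ (hE₂ _ _))
    _ = C₁ * C₂ * (∑ y'', E₂ (c₃ x) y'' * E₁ y'' y') * ‖g‖ := by
        rw [Finset.mul_sum, Finset.sum_mul]
        exact Finset.sum_congr rfl fun y'' _ => by ring

/-- **the composed operator again has block-kernel decay** (the hypothesis shape of `MinimizerSupNormBound`, so the
composition can be iterated — `G_jQ_jᵀC_jQ_jG_j` is two such steps) as soon as the one-link sum of the profiles is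
controlled: `Σ_{y″}E₂(y,y″)E₁(y″,y′) ≤ K·E(y,y′)` ⟹ constant `C₁C₂K`, profile `E`. [cite: Dimock2013BalabanII, §2.5 Lemma
bonfire proof L1268–1272 (arXiv:1212.5562v2 TeX)] -/
theorem comp_decay_of_chain {C₁ C₂ K : ℝ} {E₁ E₂ E : Y → Y → ℝ} (hC₁ : 0 ≤ C₁) (hC₂ : 0 ≤ C₂)
    (hE₁ : ∀ y y', 0 ≤ E₁ y y') (hE₂ : ∀ y y', 0 ≤ E₂ y y')
    (hker₁ : ∀ (y' : Y) (g : X₁ → ℝ), (∀ x, c₁ x ≠ y' → g x = 0) →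
      ∀ x : X₂, |T₁ g x| ≤ C₁ * E₁ (c₂ x) y' * ‖g‖)
    (hker₂ : ∀ (y'' : Y) (h : X₂ → ℝ), (∀ x, c₂ x ≠ y'' → h x = 0) →
      ∀ x : X₃, |T₂ h x| ≤ C₂ * E₂ (c₃ x) y'' * ‖h‖)
    (hchain : ∀ y y', ∑ y'', E₂ y y'' * E₁ y'' y' ≤ K * E y y') :
    ∀ (y' : Y) (g : X₁ → ℝ), (∀ x, c₁ x ≠ y' → g x = 0) →
      ∀ x : X₃, |(T₂ ∘ₗ T₁) g x| ≤ C₁ * C₂ * K * E (c₃ x) y' * ‖g‖ := by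
  intro y' g hg x
  rw [LinearMap.comp_apply]
  calc |T₂ (T₁ g) x| ≤ C₁ * C₂ * (∑ y'', E₂ (c₃ x) y'' * E₁ y'' y') * ‖g‖ :=
        comp_decay hC₁ hC₂ hE₁ hE₂ hker₁ hker₂ y' g hg x
    _ ≤ C₁ * C₂ * (K * E (c₃ x) y') * ‖g‖ :=
        mul_le_mul_of_nonneg_right (mul_le_mul_of_nonneg_left (hchain _ _) (mul_nonneg hC₁ hC₂)) (norm_nonneg _)
    _ = C₁ * C₂ * K * E (c₃ x) y' * ‖g‖ := by ring

omit [Fintype Y] in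
/-- **a BLOCK-LOCAL left factor costs no decay** (multiplication operators, `Q_j`, `Q_jᵀ`, `1_{Δ_y}`: `(T₂h)(x)` depends
only on the block of `h` at the cube of `x`, `|(T₂h)(x)| ≤ C₂‖1_{Δ_{c₃x}}h‖_∞`): `T₂T₁` keeps the profile `E₁` with constant
`C₁C₂`. [cite: Dimock2013BalabanII, §2.5 Lemma bonfire proof L1268–1272 (arXiv:1212.5562v2 TeX)] -/
theorem comp_decay_of_local_left {C₁ C₂ : ℝ} {E₁ : Y → Y → ℝ} (hC₁ : 0 ≤ C₁) (hC₂ : 0 ≤ C₂)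
    (hE₁ : ∀ y y', 0 ≤ E₁ y y')
    (hker₁ : ∀ (y' : Y) (g : X₁ → ℝ), (∀ x, c₁ x ≠ y' → g x = 0) →
      ∀ x : X₂, |T₁ g x| ≤ C₁ * E₁ (c₂ x) y' * ‖g‖)
    (hloc₂ : ∀ (h : X₂ → ℝ) (x : X₃), |T₂ h x| ≤ C₂ * ‖blk c₂ (c₃ x) h‖) :
    ∀ (y' : Y) (g : X₁ → ℝ), (∀ x, c₁ x ≠ y' → g x = 0) →
      ∀ x : X₃, |(T₂ ∘ₗ T₁) g x| ≤ C₁ * C₂ * E₁ (c₃ x) y' * ‖g‖ := by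
  intro y' g hg x
  rw [LinearMap.comp_apply]
  calc |T₂ (T₁ g) x| ≤ C₂ * ‖blk c₂ (c₃ x) (T₁ g)‖ := hloc₂ _ _
    _ ≤ C₂ * (C₁ * E₁ (c₃ x) y' * ‖g‖) := mul_le_mul_of_nonneg_left (norm_blk_apply_le hC₁ hE₁ hker₁ hg _) hC₂
    _ = C₁ * C₂ * E₁ (c₃ x) y' * ‖g‖ := by ring

omit [Fintype Y] [DecidableEq Y] in
/-- **a BLOCK-LOCAL right factor costs no decay** (`T₁` maps functions supported in `Δ_{y′}` to functions supported in
`Δ_{y′}`, with `‖T₁g‖_∞ ≤ C₁‖g‖_∞`): `T₂T₁` keeps the profile `E₂` with constant `C₁C₂`. [cite: Dimock2013BalabanII, §2.5 Lemma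
bonfire proof L1268–1272 (arXiv:1212.5562v2 TeX)] -/
theorem comp_decay_of_local_right {C₁ C₂ : ℝ} {E₂ : Y → Y → ℝ} (hC₂ : 0 ≤ C₂) (hE₂ : ∀ y y', 0 ≤ E₂ y y')
    (hsupp₁ : ∀ (y' : Y) (g : X₁ → ℝ), (∀ x, c₁ x ≠ y' → g x = 0) → ∀ x, c₂ x ≠ y' → T₁ g x = 0)
    (hbd₁ : ∀ g : X₁ → ℝ, ‖T₁ g‖ ≤ C₁ * ‖g‖)
    (hker₂ : ∀ (y'' : Y) (h : X₂ → ℝ), (∀ x, c₂ x ≠ y'' → h x = 0) →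
      ∀ x : X₃, |T₂ h x| ≤ C₂ * E₂ (c₃ x) y'' * ‖h‖) :
    ∀ (y' : Y) (g : X₁ → ℝ), (∀ x, c₁ x ≠ y' → g x = 0) →
      ∀ x : X₃, |(T₂ ∘ₗ T₁) g x| ≤ C₁ * C₂ * E₂ (c₃ x) y' * ‖g‖ := by
  intro y' g hg x
  rw [LinearMap.comp_apply]
  calc |T₂ (T₁ g) x| ≤ C₂ * E₂ (c₃ x) y' * ‖T₁ g‖ := hker₂ y' (T₁ g) (hsupp₁ y' g hg) x
    _ ≤ C₂ * E₂ (c₃ x) y' * (C₁ * ‖g‖) := mul_le_mul_of_nonneg_left (hbd₁ g) (mul_nonneg hC₂ (hE₂ _ _))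
    _ = C₁ * C₂ * E₂ (c₃ x) y' * ‖g‖ := by ring

end Composition

/-! ## §3 Exponential profiles: the one-link sum halves the rate -/

section Exponential

variable {Y : Type*} [Fintype Y]

/-- **the one-link estimate for exponential profiles**: with the triangle inequality `d(y,y′) ≤ d(y,y″) + d(y″,y′)`,
`Σ_{y″}e^{−γd(y,y″)}e^{−γd(y″,y′)} ≤ K·e^{−½γd(y,y′)}` where `K` bounds the one-link sum `Σ_{y″}e^{−½γd(y,y″)}` ((funnysum) at
`δ = ½γ`) — half the decay pays for the sum, half survives (the `n = 1` case of the chain estimate of THEOREM 2.2's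
proof, sibling `RandomWalkExpansion.sum_exp_chain_le`). [cite: Dimock2013BalabanII, §2.5 Theorem th proof L1447–1456 and
(funnysum) L1152–1156 (arXiv:1212.5562v2 TeX)] -/
theorem sum_exp_mul_exp_le {γ K : ℝ} (hγ : 0 ≤ γ) {d : Y → Y → ℝ} (hd : ∀ y y', 0 ≤ d y y')
    (htri : ∀ y y'' y', d y y' ≤ d y y'' + d y'' y') (hK : ∀ y, ∑ y'', Real.exp (-(γ / 2 * d y y'')) ≤ K)
    (y y' : Y) :
    ∑ y'', Real.exp (-(γ * d y y'')) * Real.exp (-(γ * d y'' y')) ≤ K * Real.exp (-(γ / 2 * d y y')) := by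
  have hterm : ∀ y'', Real.exp (-(γ * d y y'')) * Real.exp (-(γ * d y'' y'))
      ≤ Real.exp (-(γ / 2 * d y y'')) * Real.exp (-(γ / 2 * d y y')) := fun y'' => by
    rw [← Real.exp_add, ← Real.exp_add]
    refine Real.exp_le_exp.2 ?_
    have h1 := htri y y'' y'
    have h2 := hd y'' y'
    have h3 := hd y y''
    nlinarith
  calc ∑ y'', Real.exp (-(γ * d y y'')) * Real.exp (-(γ * d y'' y'))
      ≤ ∑ y'', Real.exp (-(γ / 2 * d y y'')) * Real.exp (-(γ / 2 * d y y')) := Finset.sum_le_sum fun y'' _ => hterm y''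
    _ = (∑ y'', Real.exp (-(γ / 2 * d y y''))) * Real.exp (-(γ / 2 * d y y')) := by rw [Finset.sum_mul]
    _ ≤ K * Real.exp (-(γ / 2 * d y y')) := mul_le_mul_of_nonneg_right (hK y) (Real.exp_nonneg _)

variable {X₁ X₂ X₃ : Type*} [Fintype X₁] [Fintype X₂] [DecidableEq Y]
variable {c₁ : X₁ → Y} {c₂ : X₂ → Y} {c₃ : X₃ → Y}
variable {T₁ : (X₁ → ℝ) →ₗ[ℝ] (X₂ → ℝ)} {T₂ : (X₂ → ℝ) →ₗ[ℝ] (X₃ → ℝ)}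

/-- **COMPOSITION WITH EXPONENTIAL PROFILES**: two factors with block decay `C_ie^{−γd}` compose to a kernel with block decay
`C₁C₂K·e^{−½γd}` — *"Here all the pieces have pointwise bounds of the form we want and this yields the result"* (the
identity `G′_j = G_j + a_j²G_jQ_jᵀC_jQ_jG_j` of the sibling `NextScalePropagatorIdentity`, with (gong1) for `G_j(□̃)` and the
bounds on `C_j` as inputs, gives (gong1)-type bounds for `G′_j(□̃)`, at a halved rate per composition).
[cite: Dimock2013BalabanII, §2.5 Lemma bonfire proof L1266–1273 (arXiv:1212.5562v2 TeX)] -/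
theorem comp_exp_decay {C₁ C₂ γ K : ℝ} (hC₁ : 0 ≤ C₁) (hC₂ : 0 ≤ C₂) (hγ : 0 ≤ γ) {d : Y → Y → ℝ}
    (hd : ∀ y y', 0 ≤ d y y') (htri : ∀ y y'' y', d y y' ≤ d y y'' + d y'' y')
    (hK : ∀ y, ∑ y'', Real.exp (-(γ / 2 * d y y'')) ≤ K)
    (hker₁ : ∀ (y' : Y) (g : X₁ → ℝ), (∀ x, c₁ x ≠ y' → g x = 0) →
      ∀ x : X₂, |T₁ g x| ≤ C₁ * Real.exp (-(γ * d (c₂ x) y')) * ‖g‖)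
    (hker₂ : ∀ (y'' : Y) (h : X₂ → ℝ), (∀ x, c₂ x ≠ y'' → h x = 0) →
      ∀ x : X₃, |T₂ h x| ≤ C₂ * Real.exp (-(γ * d (c₃ x) y'')) * ‖h‖) :
    ∀ (y' : Y) (g : X₁ → ℝ), (∀ x, c₁ x ≠ y' → g x = 0) →
      ∀ x : X₃, |(T₂ ∘ₗ T₁) g x| ≤ C₁ * C₂ * K * Real.exp (-(γ / 2 * d (c₃ x) y')) * ‖g‖ :=
  comp_decay_of_chain (E₁ := fun y y' => Real.exp (-(γ * d y y'))) (E₂ := fun y y' => Real.exp (-(γ * d y y')))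
    (E := fun y y' => Real.exp (-(γ / 2 * d y y'))) hC₁ hC₂ (fun _ _ => Real.exp_nonneg _)
    (fun _ _ => Real.exp_nonneg _) hker₁ hker₂ (fun y y' => sum_exp_mul_exp_le hγ hd htri hK y y')

end Exponential

/-! ## §4 Remark 2 after LEMMA 2.6: (another) from (lefty) when `|j − j′| ≤ 1` -/

/-- **(another) ⟸ (lefty)**: for levels `j ≤ j′ + 1` (in particular `|j − j′| ≤ 1`) and `L ≥ 1`, `L^{−2(k−j)} ≤
L²·L^{−2(k−j′)}` — so a bound
with the weight `L^{−2(k−j)}` of the TARGET cube (lefty) implies the bound with the weight `L^{−2(k−j′)}` of the SOURCE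
cube (another) at the price of an `L`-dependent constant (*"Since |j − j′| ≤ 1 this follows from (lefty)"*).
[cite: Dimock2013BalabanII, §2.5 Remark 2 after Lemma bonfire, (another) L1207–1218 (arXiv:1212.5562v2 TeX)] -/
theorem weight_target_le_source {L : ℝ} (hL : 1 ≤ L) {k j j' : ℕ} (h : j ≤ j' + 1) :
    (L ^ (2 * (k - j)))⁻¹ ≤ L ^ 2 * (L ^ (2 * (k - j')))⁻¹ := by
  have hL0 : 0 < L := by linarith
  have hpow : L ^ (2 * (k - j')) ≤ L ^ (2 * (k - j) + 2) :=
    pow_le_pow_right₀ hL (by omega)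
  rw [← div_eq_mul_inv, le_div_iff₀ (pow_pos hL0 _)]
  calc (L ^ (2 * (k - j)))⁻¹ * L ^ (2 * (k - j')) ≤ (L ^ (2 * (k - j)))⁻¹ * L ^ (2 * (k - j) + 2) :=
        mul_le_mul_of_nonneg_left hpow (inv_nonneg.2 (pow_nonneg hL0.le _))
    _ = L ^ 2 := by rw [pow_add, ← mul_assoc, inv_mul_cancel₀ (pow_ne_zero _ hL0.ne'), one_mul]

/-- hence a kernel bound with the target weight (lefty) yields the source-weight form (another) with constant `CL²`.
[cite: Dimock2013BalabanII, §2.5 Remark 2 after Lemma bonfire, (another) L1207–1218 (arXiv:1212.5562v2 TeX)] -/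
theorem another_of_lefty {L C E n : ℝ} (hL : 1 ≤ L) (hC : 0 ≤ C) (hE : 0 ≤ E) (hn : 0 ≤ n) {k j j' : ℕ}
    (h : j ≤ j' + 1) {v : ℝ} (hv : |v| ≤ C * (L ^ (2 * (k - j)))⁻¹ * E * n) :
    |v| ≤ C * L ^ 2 * (L ^ (2 * (k - j')))⁻¹ * E * n := by
  calc |v| ≤ C * (L ^ (2 * (k - j)))⁻¹ * E * n := hv
    _ ≤ C * (L ^ 2 * (L ^ (2 * (k - j')))⁻¹) * E * n := by
        have := weight_target_le_source (k := k) hL h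
        gcongr
    _ = C * L ^ 2 * (L ^ (2 * (k - j')))⁻¹ * E * n := by ring

/-! ## §5 Non-vacuity -/

/-- two cubes, identity operators: `T₁ = T₂ = id` on `Bool → ℝ` have block decay with `C = 1` and the profile
`E(y,y′) = [y = y′]`; the composite bound of `comp_decay` is then `Σ_{y″}[y = y″][y″ = y′] = [y = y′]`, attained. -/
example : ∀ (y' : Bool) (g : Bool → ℝ), (∀ x, id x ≠ y' → g x = 0) →
    ∀ x : Bool, |(LinearMap.id ∘ₗ LinearMap.id : (Bool → ℝ) →ₗ[ℝ] (Bool → ℝ)) g x|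
      ≤ 1 * 1 * 1 * (fun y y' : Bool => if y = y' then (1 : ℝ) else 0) (id x) y' * ‖g‖ := by
  refine comp_decay_of_chain (X₂ := Bool) (c₁ := id) (c₂ := id) (c₃ := id)
    (T₁ := (LinearMap.id : (Bool → ℝ) →ₗ[ℝ] (Bool → ℝ))) (T₂ := (LinearMap.id : (Bool → ℝ) →ₗ[ℝ] (Bool → ℝ)))
    (E₁ := fun y y' : Bool => if y = y' then (1 : ℝ) else 0)
    (E₂ := fun y y' : Bool => if y = y' then (1 : ℝ) else 0) (K := 1)
    (E := fun y y' : Bool => if y = y' then (1 : ℝ) else 0) zero_le_one zero_le_one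
    (fun _ _ => by positivity) (fun _ _ => by positivity) ?_ ?_ ?_
  · intro y' g hg x
    by_cases hx : x = y'
    · subst hx; simpa using norm_le_pi_norm g x
    · have h0 : g x = 0 := hg x hx
      simp [hx, h0]
  · intro y'' h hh x
    by_cases hx : x = y''
    · subst hx; simpa using norm_le_pi_norm h x
    · have h0 : h x = 0 := hh x hx
      simp [hx, h0]
  · intro y y'
    simp

end Literature.MathematicalPhysics.QuantumFieldTheory.Dimock2011to13.DecayingKernelComposition
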